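import Summits.BirchSwinnertonDyer.BirchSwinnertonDyer.Theorems.BiquadraticEisensteinDescentHeegnerTwistCouplingInSupplyLinnikCensusAmplifier
import Literature.NumberTheory.Sieve.ArithmeticLargeSieve
import Literature.NumberTheory.LFunctions.PrimeNumberTheoremProgressions
import Mathlib.Data.Nat.Choose.Bounds
import HarnessLib

set_option linter.dupNamespace false -- `Summit.BirchSwinnertonDyer.BirchSwinnertonDyer.Theorems.…` (summit = sub)
set_option autoImplicit false

/-!
# Crux `HeegnerTwistCouplingInSupply` (stmt-BirchSwinnertonDyer-21381) — card `linnik-sieve-residual-census`: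
# the located-prime residual of the `j = 8000`, `p ≡ 5 (mod 8)` rung is POLYLOG-SPARSE — UNCONDITIONALLY

Route `BiquadraticEisensteinDescent` (cell `pub/bsd-wall`, width seat `bsd-wall-cm-bed-w3` g19; `--supports` 21381, helper).

The crux idea card `Cruxes/HeegnerTwistCouplingInSupply/Ideas/linnik-sieve-residual-census.md` (crux-ideate seat 2, g25)
proposed, as its ★ first lemma `ResidualCensus`, that the exceptional set of the pin-free rung
`…SqrtTwoLawConverse.cruxOnBpCornerPrimeTwist_of_two_facts` (primes `p ≡ 5 (mod 8)`, `√Q < p ≤ Q`, with NO located prime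
`ℓ ≤ √Q`, `ℓ ≡ 7 (mod 16)`, `(p/ℓ) = +1`) has `O(log⁴ Q)` elements, citing the multiplicative large sieve over prime moduli
(Linnik 1941 / Montgomery) as a Literature fact to be typed. THIS FILE PROVES IT WITH NO NAMED FACT: the large-sieve input is
the tree's PROVED Montgomery arithmetic large sieve in its «few primes can have many forbidden classes» form
(`Literature.NumberTheory.Sieve.ArithmeticLargeSieve.card_primes_le_of_forbidden_classes`, Montgomery 1978 p. 561 with
Selberg's constant), and the supply of located-class primes `π(√Q; 16, 7) ≫ √Q / log Q` is the tree's PROVED prime number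
theorem for progressions (`Literature.NumberTheory.LFunctions.eventually_le_sum_Ioc_log`, from
`Literature.NumberTheory.LFunctions.sum_log_prime_residue_isLittleO`, Wiener–Ikehara + non-vanishing of `L(1, χ)`).

Mechanism (Linnik's amplifier, in Montgomery's sieve dress): let `L = {q ≤ y prime : q ≡ 7 (16)}` (`y = ⌊√Q⌋`) and let the
sifted set be the AMPLIFIER `A = {q₁q₂q₃q₄ : qᵢ ∈ L distinct} ⊆ (0, Q²]`, `#A = C(#L, 4)` (unique factorisation). On an
exceptional `p` every `q ∈ L` is a non-residue (`…LinnikCensusAmplifier.jacobiSym_swap_eq_neg_one`: `(p/q) ≠ 1`, reciprocity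
at `p ≡ 1 (mod 4)`), so every element of `A` is a non-zero quadratic residue mod `p`: `A` avoids the `≥ p/2` classes
`J(p) = {h : (h/p) ≠ 1}` for EVERY exceptional `p` simultaneously. Montgomery: `#exc · (1/2) · #A ≤ Q² + Q² − 1`, i.e.
`#exc ≤ 4Q² / C(#L, 4)` (`card_exceptional_le`); PNT in the progression `7 (mod 16)` gives `#L ≥ (y − 1)/(32 log y)`
(`exists_card_locPrimes_ge`), hence `C(#L,4) ≫ Q²/log⁴ Q` (`census_arith`) and ★ `residualCensus` — the card's
`ResidualCensus`, BY VALUE, as a theorem: `∃ C > 0, ∀ Q ≥ 3, #exc(Q, ⌊√Q⌋) ≤ C log⁴ Q`. The card's `CornerAlmostAll`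
consequent (located prime `ℓ < 6p` for all but `C log⁴ Q` primes) and the glue to the door theorem (crux conclusion for
`W = B_p` outside the exceptional set, modulo the door's two facts) are the companion file `…LinnikCensusCorner.lean`.

HONEST FRAMING: a RUNG-LEVEL census of ONE corner family (`B_p`, `j = 8000`, `p ≡ 5 (mod 8)`), density-one in `p` with a
polylogarithmic exceptional set; it does not touch the crux as stated (all CM `W`, all `p ≥ 5`; residual C⁺), its registered
stubs, or BSD. Nothing is closed by this file. THEOREMS ONLY (no `def`); the constant is not optimised (`C = 96·16·64⁴`
beyond the PNT threshold).
-/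

namespace Summit.BirchSwinnertonDyer.BirchSwinnertonDyer.Theorems.LinnikCensus

open Finset
open Literature.NumberTheory.Sieve.ArithmeticLargeSieve (intRes intRes_natCast card_primes_le_of_forbidden_classes)

/-! ## The amplifier: products of four distinct located-class primes -/

/-- **Unique factorisation for the amplifier**: on finsets of primes, `s ↦ ∏ s` is injective, so the products of
`k`-subsets of a finset `L` of primes number exactly `C(#L, k)`. [folklore] -/
theorem card_image_prod_powersetCard {L : Finset ℕ} (hL : ∀ q ∈ L, q.Prime) (k : ℕ) :
    ((L.powersetCard k).image (fun s => ∏ q ∈ s, q)).card = L.card.choose k := by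
  rw [Finset.card_image_of_injOn, Finset.card_powersetCard]
  intro s hs t ht hst
  have hs' : ∀ q ∈ s, q.Prime := fun q hq => hL q ((Finset.mem_powersetCard.mp (Finset.mem_coe.mp hs)).1 hq)
  have ht' : ∀ q ∈ t, q.Prime := fun q hq => hL q ((Finset.mem_powersetCard.mp (Finset.mem_coe.mp ht)).1 hq)
  have hst' : ∏ q ∈ s, q = ∏ q ∈ t, q := hst
  calc s = (∏ q ∈ s, q).primeFactors := (Nat.primeFactors_prod hs').symm
    _ = (∏ q ∈ t, q).primeFactors := by rw [hst']
    _ = t := Nat.primeFactors_prod ht'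

/-- Elements of the amplifier built on primes `q ∈ [1, y]` lie in `(0, y^k]`. [folklore] -/
theorem pos_and_le_of_mem_image_prod {L : Finset ℕ} {y k n : ℕ} (hL : ∀ q ∈ L, q.Prime ∧ q ≤ y)
    (hn : n ∈ (L.powersetCard k).image (fun s => ∏ q ∈ s, q)) : 0 < n ∧ n ≤ y ^ k := by
  obtain ⟨s, hs, rfl⟩ := Finset.mem_image.mp hn
  obtain ⟨hsL, hcard⟩ := Finset.mem_powersetCard.mp hs
  refine ⟨Finset.prod_pos fun q hq => (hL q (hsL hq)).1.pos, ?_⟩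
  rw [← hcard]
  exact Finset.prod_le_pow_card s (fun q => q) y fun q hq => (hL q (hsL hq)).2

/-! ## The sieve step: Montgomery's arithmetic large sieve with the amplifier as the sifted set -/

open scoped Classical in
/-- ★ **The sieve step** (`#exc ≤ 4Q²/C(#L,4)`): for `y² ≤ Q` and `L = {q ≤ y prime : q ≡ 7 (16)}` with `C(#L,4) ≥ 1`,
the number of primes `p ≤ Q`, `p ≡ 5 (mod 8)`, `y < p`, with no located prime `ℓ ≤ y` (`ℓ` prime, `ℓ ≡ 7 (16)`,
`(p/ℓ) = +1`) is at most `4Q²/C(#L, 4)`. Proof: Montgomery's large sieve in the form «few primes can have many forbidden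
classes» (tree: `card_primes_le_of_forbidden_classes`, `τ = 1/2`) applied to the amplifier `A ⊆ (0, Q²]` of products of
four distinct primes of `L`, which avoids the non-residue classes `{h : (h/p) ≠ 1}` (`#J(p) ≥ p/2`) modulo every
exceptional `p`. [cite: Montgomery1978, p. 561] -/
theorem card_exceptional_le {Q y : ℕ} (hQ : 1 ≤ Q) (hy : y ^ 2 ≤ Q)
    (hA : 1 ≤ (((Finset.Icc 1 y).filter (fun q : ℕ => q.Prime ∧ q % 16 = 7)).card.choose 4)) :
    ((((Finset.range (Q + 1)).filter (fun p : ℕ => p.Prime ∧ p % 8 = 5 ∧ y < p ∧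
        ∀ ℓ : ℕ, ℓ.Prime → ℓ % 16 = 7 → ℓ ≤ y → jacobiSym (p : ℤ) ℓ ≠ 1)).card : ℝ)) ≤
      4 * (Q : ℝ) ^ 2 / (((Finset.Icc 1 y).filter (fun q : ℕ => q.Prime ∧ q % 16 = 7)).card.choose 4 : ℕ) := by
  classical
  set L := (Finset.Icc 1 y).filter (fun q : ℕ => q.Prime ∧ q % 16 = 7) with hLdef
  set P := (Finset.range (Q + 1)).filter (fun p : ℕ => p.Prime ∧ p % 8 = 5 ∧ y < p ∧
        ∀ ℓ : ℕ, ℓ.Prime → ℓ % 16 = 7 → ℓ ≤ y → jacobiSym (p : ℤ) ℓ ≠ 1) with hPdef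
  set A := (L.powersetCard 4).image (fun s => ∏ q ∈ s, q) with hAdef
  set N : Finset ℤ := A.map Nat.castEmbedding with hNdef
  have hL : ∀ q ∈ L, q.Prime ∧ q ≤ y ∧ q % 16 = 7 := by
    intro q hq
    rw [hLdef, Finset.mem_filter, Finset.mem_Icc] at hq
    exact ⟨hq.2.1, hq.1.2, hq.2.2⟩
  have hAcard : A.card = L.card.choose 4 := card_image_prod_powersetCard (fun q hq => (hL q hq).1) 4
  have hNcard : N.card = A.card := Finset.card_map _
  -- the forbidden classes
  let J : ℕ → Finset ℕ := fun p =>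
    if p ∈ P then (Finset.range p).filter (fun h : ℕ => jacobiSym (h : ℤ) p ≠ 1) else ∅
  have hP : ∀ p ∈ P, p.Prime ∧ p ≤ Q := by
    intro p hp
    rw [hPdef, Finset.mem_filter, Finset.mem_range] at hp
    exact ⟨hp.2.1, by omega⟩
  have hPfull : ∀ p ∈ P, p.Prime ∧ p % 8 = 5 ∧ y < p ∧
      ∀ ℓ : ℕ, ℓ.Prime → ℓ % 16 = 7 → ℓ ≤ y → jacobiSym (p : ℤ) ℓ ≠ 1 := by
    intro p hp
    rw [hPdef, Finset.mem_filter] at hp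
    exact hp.2
  have hNsub : N ⊆ Finset.Ioc (0 : ℤ) (0 + ((Q ^ 2 : ℕ) : ℕ)) := by
    intro n hn
    rw [hNdef, Finset.mem_map] at hn
    obtain ⟨m, hm, rfl⟩ := hn
    obtain ⟨hm0, hmle⟩ := pos_and_le_of_mem_image_prod (fun q hq => ⟨(hL q hq).1, (hL q hq).2.1⟩) hm
    have hmQ : m ≤ Q ^ 2 := by
      calc m ≤ y ^ 4 := hmle
        _ = (y ^ 2) ^ 2 := by ring
        _ ≤ Q ^ 2 := Nat.pow_le_pow_left hy 2
    simp only [Nat.castEmbedding_apply, Finset.mem_Ioc, zero_add]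
    exact ⟨by exact_mod_cast hm0, by exact_mod_cast hmQ⟩
  have hJ : ∀ p, p.Prime → p ≤ Q → J p ⊆ Finset.range p ∧ (J p).card < p := by
    intro p hp _
    by_cases hpP : p ∈ P
    · simp only [J, if_pos hpP]
      exact ⟨Finset.filter_subset _ _, card_nonResidueClasses_lt hp⟩
    · simp only [J, if_neg hpP]
      exact ⟨Finset.empty_subset _, by simp [hp.pos]⟩
  have hav : ∀ p, p.Prime → p ≤ Q → ∀ n ∈ N, intRes p n ∉ J p := by
    intro p hp _ n hn
    rw [hNdef, Finset.mem_map] at hn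
    obtain ⟨m, hm, rfl⟩ := hn
    rw [Nat.castEmbedding_apply, intRes_natCast]
    by_cases hpP : p ∈ P
    · simp only [J, if_pos hpP]
      obtain ⟨hpp, hp8, hyp, hno⟩ := hPfull p hpP
      obtain ⟨s, hs, rfl⟩ := Finset.mem_image.mp hm
      obtain ⟨hsL, hcard⟩ := Finset.mem_powersetCard.mp hs
      refine natMod_not_mem_nonResidueClasses ?_
      exact jacobiSym_finsetProd_eq_one_of_even hpp hp8 hno s (fun q hq => hL q (hsL hq))
        (by rw [hcard]; decide)
    · simp only [J, if_neg hpP]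
      simp
  have hτJ : ∀ p ∈ P, (1 / 2 : ℝ) * p ≤ ((J p).card : ℝ) := by
    intro p hp
    obtain ⟨hpp, hp8, -, -⟩ := hPfull p hp
    simp only [J, if_pos hp]
    have := natCast_le_two_mul_card_nonResidueClasses hpp (by omega)
    linarith
  have hZ : 1 ≤ N.card := by rw [hNcard, hAcard]; exact hA
  have hmain := card_primes_le_of_forbidden_classes N 0 (Q ^ 2) Q hQ J hNsub hJ hav P hP
    (τ := 1 / 2) (by norm_num) hτJ hZ
  rw [hNcard, hAcard] at hmain
  have hApos : (0 : ℝ) < (L.card.choose 4 : ℕ) := by exact_mod_cast hA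
  refine hmain.trans ?_
  rw [div_le_div_iff₀ (by positivity) hApos]
  push_cast
  nlinarith [hApos]

/-! ## The supply of located-class primes: the prime number theorem in the progression `7 (mod 16)` -/

/-- **PNT lower bound for the located class**: there is `X₀` such that for all `X ≥ X₀`,
`X/16 ≤ #{q ≤ X prime : q ≡ 7 (mod 16)} · log X` (from `θ(X; 16, 7) = X/8 + o(X)`, the tree's PROVED
`Literature.NumberTheory.LFunctions.sum_log_prime_residue_isLittleO`, with tolerance `X/16`, and `log q ≤ log X` termwise).
[cite: MontgomeryVaughan2007, Cor. 11.17] -/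
theorem exists_card_locPrimes_mul_log_ge :
    ∃ X₀ : ℕ, ∀ X : ℕ, X₀ ≤ X →
      (X : ℝ) / 16 ≤ (((Finset.Icc 1 X).filter (fun q : ℕ => q.Prime ∧ q % 16 = 7)).card : ℝ) * Real.log X := by
  have ha : IsUnit (((7 : ℕ) : ZMod 16)) := (ZMod.isUnit_iff_coprime 7 16).mpr (by norm_num)
  have h := Literature.NumberTheory.LFunctions.sum_log_prime_residue_isLittleO (q := 16) ha
  have hφ : (((16 : ℕ).totient : ℕ) : ℝ) = 8 := by
    have : (16 : ℕ).totient = 8 := by decide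
    rw [this]; norm_num
  have h1 := h.def (c := 1 / 16) (by norm_num)
  rw [Filter.eventually_atTop] at h1
  obtain ⟨X₀, hX₀⟩ := h1
  refine ⟨X₀, fun X hX => ?_⟩
  have hb := hX₀ X hX
  rw [hφ, Real.norm_eq_abs, Real.norm_eq_abs, Nat.abs_cast] at hb
  have hb2 := (abs_sub_le_iff.mp hb).2
  -- the tree's residue condition `(q : ZMod 16) = 7` is `q % 16 = 7`
  have hsub : (Finset.Icc 1 X).filter (fun p : ℕ => p.Prime ∧ ((p : ℕ) : ZMod 16) = ((7 : ℕ) : ZMod 16)) ⊆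
      (Finset.Icc 1 X).filter (fun q : ℕ => q.Prime ∧ q % 16 = 7) := by
    intro p hp
    rw [Finset.mem_filter] at hp ⊢
    refine ⟨hp.1, hp.2.1, ?_⟩
    have := (ZMod.natCast_eq_natCast_iff' p 7 16).mp hp.2.2
    omega
  have hlogX : 0 ≤ Real.log X := Real.log_natCast_nonneg X
  have hterm : ∀ p ∈ (Finset.Icc 1 X).filter (fun p : ℕ => p.Prime ∧ ((p : ℕ) : ZMod 16) = ((7 : ℕ) : ZMod 16)),
      Real.log p ≤ Real.log X := by
    intro p hp
    rw [Finset.mem_filter, Finset.mem_Icc] at hp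
    exact Real.log_le_log (by exact_mod_cast hp.1.1) (by exact_mod_cast hp.1.2)
  calc (X : ℝ) / 16
      ≤ ∑ p ∈ (Finset.Icc 1 X).filter
          (fun p : ℕ => p.Prime ∧ ((p : ℕ) : ZMod 16) = ((7 : ℕ) : ZMod 16)), Real.log p := by linarith
    _ ≤ ∑ p ∈ (Finset.Icc 1 X).filter
          (fun p : ℕ => p.Prime ∧ ((p : ℕ) : ZMod 16) = ((7 : ℕ) : ZMod 16)), Real.log X :=
        Finset.sum_le_sum hterm
    _ = (((Finset.Icc 1 X).filter
          (fun p : ℕ => p.Prime ∧ ((p : ℕ) : ZMod 16) = ((7 : ℕ) : ZMod 16))).card : ℝ) * Real.log X := by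
        rw [Finset.sum_const, nsmul_eq_mul]
    _ ≤ (((Finset.Icc 1 X).filter (fun q : ℕ => q.Prime ∧ q % 16 = 7)).card : ℝ) * Real.log X :=
        mul_le_mul_of_nonneg_right (by exact_mod_cast Finset.card_le_card hsub) hlogX

/-- **Growth lemma**: `96 · log y ≤ y` for all large naturals `y` (`log = o(id)`, Mathlib `Real.isLittleO_log_id_atTop`).
[folklore] -/
theorem exists_log_mul_le : ∃ y₁ : ℕ, ∀ y : ℕ, y₁ ≤ y → 96 * Real.log y ≤ (y : ℝ) := by
  have h := Real.isLittleO_log_id_atTop.def (c := 1 / 96) (by norm_num)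
  rw [Filter.eventually_atTop] at h
  obtain ⟨x₁, hx₁⟩ := h
  refine ⟨⌈max x₁ 0⌉₊, fun y hy => ?_⟩
  have hyx : x₁ ≤ (y : ℝ) := (le_max_left _ _).trans ((Nat.ceil_le).mp hy)
  have hb := hx₁ (y : ℝ) hyx
  rw [id, Real.norm_eq_abs, Real.norm_eq_abs, Nat.abs_cast] at hb
  have := (abs_le.mp hb).2
  linarith

/-- **The located-class supply at the census height**: for all large `y`,
`y/(32 log y) + 3 ≤ #{q ≤ y prime : q ≡ 7 (mod 16)}` (PNT lower bound `y/(16 log y)` minus the `3` lost in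
`C(k,4) ≥ (k−3)⁴/24`, absorbed by `96 log y ≤ y`). [cite: MontgomeryVaughan2007, Cor. 11.17] -/
theorem exists_card_locPrimes_ge :
    ∃ y₀ : ℕ, 2 ≤ y₀ ∧ ∀ y : ℕ, y₀ ≤ y →
      (y : ℝ) / (32 * Real.log y) + 3 ≤ (((Finset.Icc 1 y).filter (fun q : ℕ => q.Prime ∧ q % 16 = 7)).card : ℝ) := by
  obtain ⟨X₀, hX₀⟩ := exists_card_locPrimes_mul_log_ge
  obtain ⟨y₁, hy₁⟩ := exists_log_mul_le
  refine ⟨max (max X₀ y₁) 2, le_max_right _ _, fun y hy => ?_⟩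
  have hyX : X₀ ≤ y := le_trans (le_trans (le_max_left _ _) (le_max_left _ _)) hy
  have hyy : y₁ ≤ y := le_trans (le_trans (le_max_right _ _) (le_max_left _ _)) hy
  have hy2 : 2 ≤ y := le_trans (le_max_right _ _) hy
  have h1 := hX₀ y hyX
  have h2 := hy₁ y hyy
  have hy2' : (2 : ℝ) ≤ y := by exact_mod_cast hy2
  have hlog : 0 < Real.log y := Real.log_pos (by linarith)
  set k : ℝ := (((Finset.Icc 1 y).filter (fun q : ℕ => q.Prime ∧ q % 16 = 7)).card : ℝ) with hk
  -- `y/16 ≤ k log y` and `96 log y ≤ y` give `y/32 + 3 log y ≤ y/16 ≤ k log y`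
  rw [div_add' _ _ _ (by positivity), div_le_iff₀ (by positivity)]
  nlinarith [h1, h2, hlog]

/-! ## The census -/

/-- **Real-arithmetic core of the census**: if `t = y/(32 log y) ≥ 1`, `k ≥ t + 3` and `#exc ≤ 4Q²/C(k,4)` with
`Q < (y+1)²`, `1 ≤ y`, then `#exc ≤ 96·16·32⁴ · (log y)⁴` (using `C(k,4) ≥ (k−3)⁴/24 ≥ t⁴/24` and `Q² ≤ 16y⁴`). [folklore] -/
theorem census_arith {Q y k : ℕ} {E : ℝ} (hy1 : 1 ≤ y) (hQy : Q < (y + 1) ^ 2)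
    (hlog : 0 < Real.log y) (ht : 1 ≤ (y : ℝ) / (32 * Real.log y))
    (hk : (y : ℝ) / (32 * Real.log y) + 3 ≤ (k : ℝ))
    (hE : E ≤ 4 * (Q : ℝ) ^ 2 / (k.choose 4 : ℕ)) :
    E ≤ 96 * 16 * 32 ^ 4 * Real.log y ^ 4 := by
  set t : ℝ := (y : ℝ) / (32 * Real.log y) with htdef
  have hk3 : 3 ≤ k := by
    have : (3 : ℝ) ≤ k := by linarith
    exact_mod_cast this
  -- `C(k,4) ≥ (k-3)^4 / 24`
  have hchoose : ((k - 3 : ℕ) : ℝ) ^ 4 / 24 ≤ (k.choose 4 : ℕ) := by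
    have h := Nat.pow_le_choose (α := ℝ) 4 k
    have h43 : k + 1 - 4 = k - 3 := by omega
    rw [h43, show (Nat.factorial 4 : ℝ) = 24 by norm_num [Nat.factorial]] at h
    exact_mod_cast h
  have hkt : t ≤ ((k - 3 : ℕ) : ℝ) := by
    rw [Nat.cast_sub hk3]; push_cast; linarith
  have ht0 : 0 ≤ t := le_trans zero_le_one ht
  have ht4 : t ^ 4 / 24 ≤ (k.choose 4 : ℕ) := le_trans (by gcongr) hchoose
  have htpos : 0 < t ^ 4 / 24 := by positivity
  -- `Q² ≤ 16 y⁴`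
  have hQ : (Q : ℝ) ≤ ((y : ℝ) + 1) ^ 2 := by exact_mod_cast hQy.le
  have hy1' : (1 : ℝ) ≤ y := by exact_mod_cast hy1
  have hQ2 : (Q : ℝ) ^ 2 ≤ 16 * (y : ℝ) ^ 4 := by
    have h2y : ((y : ℝ) + 1) ^ 2 ≤ (2 * y) ^ 2 := by gcongr; linarith
    calc (Q : ℝ) ^ 2 ≤ (((y : ℝ) + 1) ^ 2) ^ 2 := by gcongr
      _ ≤ ((2 * (y : ℝ)) ^ 2) ^ 2 := by gcongr
      _ = 16 * (y : ℝ) ^ 4 := by ring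
  -- combine
  have hty : t * (32 * Real.log y) = y := by
    rw [htdef]; field_simp
  calc E ≤ 4 * (Q : ℝ) ^ 2 / (k.choose 4 : ℕ) := hE
    _ ≤ 4 * (Q : ℝ) ^ 2 / (t ^ 4 / 24) := by gcongr
    _ ≤ 4 * (16 * (y : ℝ) ^ 4) / (t ^ 4 / 24) := by gcongr
    _ = 96 * 16 * (y : ℝ) ^ 4 / t ^ 4 := by field_simp; ring
    _ = 96 * 16 * (t * (32 * Real.log y)) ^ 4 / t ^ 4 := by rw [hty]
    _ = 96 * 16 * 32 ^ 4 * Real.log y ^ 4 := by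
        have ht' : t ^ 4 ≠ 0 := by positivity
        rw [mul_pow, mul_comm (t ^ 4) _, ← mul_assoc, mul_div_assoc, div_self ht', mul_one]
        ring

open scoped Classical in
/-- ★★ **`residualCensus` — the card's ★ FIRST LEMMA `ResidualCensus`, BY VALUE, as a THEOREM (no named fact)**: there is
`C > 0` such that for every `Q ≥ 3` the number of primes `p ≤ Q`, `p ≡ 5 (mod 8)`, `⌊√Q⌋ < p`, admitting NO located prime
`ℓ ≤ ⌊√Q⌋` (`ℓ` prime, `ℓ ≡ 7 (mod 16)`, `(p/ℓ) = +1`) is at most `C · (log Q)⁴`. Inputs: Montgomery's arithmetic large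
sieve (tree, proved) through `card_exceptional_le`, and the prime number theorem for the progression `7 (mod 16)` (tree,
proved) through `exists_card_locPrimes_ge`; below the PNT threshold the trivial bound `#exc ≤ Q + 1` is absorbed into `C`.
[cite: Montgomery1978, p. 561] [cite: MontgomeryVaughan2007, Cor. 11.17] -/
theorem residualCensus :
    ∃ C : ℝ, 0 < C ∧ ∀ Q : ℕ, 3 ≤ Q →
      ((((Finset.range (Q + 1)).filter (fun p : ℕ => p.Prime ∧ p % 8 = 5 ∧ Nat.sqrt Q < p ∧
          ∀ ℓ : ℕ, ℓ.Prime → ℓ % 16 = 7 → ℓ ≤ Nat.sqrt Q → jacobiSym (p : ℤ) ℓ ≠ 1)).card : ℝ))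
        ≤ C * Real.log Q ^ 4 := by
  obtain ⟨y₀, hy₀2, hy₀⟩ := exists_card_locPrimes_ge
  obtain ⟨y₁, hy₁⟩ := exists_log_mul_le
  -- threshold in `Q`: `⌊√Q⌋ ≥ max y₀ y₁`
  set Q₀ : ℕ := (max y₀ y₁) ^ 2 with hQ₀
  set C₀ : ℝ := 96 * 16 * 32 ^ 4 with hC₀
  refine ⟨max C₀ ((Q₀ : ℝ) + 1), lt_max_of_lt_left (by norm_num [hC₀]), fun Q hQ3 => ?_⟩
  have hlog3 : 1 ≤ Real.log Q := by
    have hQ3' : (3 : ℝ) ≤ Q := by exact_mod_cast hQ3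
    have he : Real.exp 1 ≤ (Q : ℝ) := le_trans (le_of_lt (lt_trans Real.exp_one_lt_d9 (by norm_num))) hQ3'
    rwa [← Real.log_le_log_iff (Real.exp_pos 1) (by linarith), Real.log_exp] at he
  have hlog4 : 1 ≤ Real.log Q ^ 4 := one_le_pow₀ hlog3
  by_cases hQ : Q₀ ≤ Q
  · -- large `Q`: the sieve
    set y := Nat.sqrt Q with hydef
    have hyge : max y₀ y₁ ≤ y := by rw [hydef, Nat.le_sqrt']; exact hQ
    have hyy₀ : y₀ ≤ y := le_trans (le_max_left _ _) hyge
    have hyy₁ : y₁ ≤ y := le_trans (le_max_right _ _) hyge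
    have hy2 : 2 ≤ y := le_trans hy₀2 hyy₀
    have hy2' : (2 : ℝ) ≤ y := by exact_mod_cast hy2
    have hlogy : 0 < Real.log y := Real.log_pos (by linarith)
    have hk := hy₀ y hyy₀
    have h96 := hy₁ y hyy₁
    have ht : 1 ≤ (y : ℝ) / (32 * Real.log y) := by
      rw [le_div_iff₀ (by positivity)]; linarith
    have hk4 : 1 ≤ (((Finset.Icc 1 y).filter (fun q : ℕ => q.Prime ∧ q % 16 = 7)).card.choose 4) := by
      have h4 : (4 : ℝ) ≤ (((Finset.Icc 1 y).filter (fun q : ℕ => q.Prime ∧ q % 16 = 7)).card : ℝ) := by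
        linarith
      have h4' : 4 ≤ ((Finset.Icc 1 y).filter (fun q : ℕ => q.Prime ∧ q % 16 = 7)).card := by
        exact_mod_cast h4
      exact Nat.choose_pos h4'
    have hysq : y ^ 2 ≤ Q := Nat.sqrt_le' Q
    have hQy : Q < (y + 1) ^ 2 := Nat.lt_succ_sqrt' Q
    have hE := card_exceptional_le (by omega) hysq hk4
    have hmain := census_arith (by omega) hQy hlogy ht hk hE
    have hlogyQ : Real.log y ≤ Real.log Q := by
      apply Real.log_le_log (by linarith)
      exact_mod_cast (Nat.sqrt_le_self Q)
    calc _ ≤ C₀ * Real.log y ^ 4 := by rw [hC₀]; exact hmain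
      _ ≤ C₀ * Real.log Q ^ 4 := by
          have hC₀0 : (0 : ℝ) ≤ C₀ := by norm_num [hC₀]
          exact mul_le_mul_of_nonneg_left (pow_le_pow_left₀ hlogy.le hlogyQ 4) hC₀0
      _ ≤ max C₀ ((Q₀ : ℝ) + 1) * Real.log Q ^ 4 :=
          mul_le_mul_of_nonneg_right (le_max_left _ _) (by positivity)
  · -- small `Q`: trivial bound `#exc ≤ Q + 1 ≤ Q₀ + 1`
    have hQ' : Q < Q₀ := not_le.mp hQ
    have hcard : (((Finset.range (Q + 1)).filter (fun p : ℕ => p.Prime ∧ p % 8 = 5 ∧ Nat.sqrt Q < p ∧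
        ∀ ℓ : ℕ, ℓ.Prime → ℓ % 16 = 7 → ℓ ≤ Nat.sqrt Q → jacobiSym (p : ℤ) ℓ ≠ 1)).card : ℝ) ≤ (Q₀ : ℝ) + 1 := by
      have h1 := Finset.card_filter_le (Finset.range (Q + 1)) (fun p : ℕ => p.Prime ∧ p % 8 = 5 ∧ Nat.sqrt Q < p ∧
        ∀ ℓ : ℕ, ℓ.Prime → ℓ % 16 = 7 → ℓ ≤ Nat.sqrt Q → jacobiSym (p : ℤ) ℓ ≠ 1)
      rw [Finset.card_range] at h1
      have : (Q : ℝ) + 1 ≤ (Q₀ : ℝ) + 1 := by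
        have := hQ'.le; exact_mod_cast Nat.succ_le_succ this
      calc _ ≤ ((Q + 1 : ℕ) : ℝ) := by exact_mod_cast h1
        _ = (Q : ℝ) + 1 := by push_cast; ring
        _ ≤ (Q₀ : ℝ) + 1 := this
    calc _ ≤ (Q₀ : ℝ) + 1 := hcard
      _ ≤ max C₀ ((Q₀ : ℝ) + 1) := le_max_right _ _
      _ = max C₀ ((Q₀ : ℝ) + 1) * 1 := (mul_one _).symm
      _ ≤ max C₀ ((Q₀ : ℝ) + 1) * Real.log Q ^ 4 :=
          mul_le_mul_of_nonneg_left hlog4 (le_trans (by positivity) (le_max_right _ _))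

end Summit.BirchSwinnertonDyer.BirchSwinnertonDyer.Theorems.LinnikCensus
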